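import Summits.HubbardSuperconductivity.HubbardSuperconductivity.Theorems.AnisotropyChordStiffnessTwistSkeleton

/-!
# Route `AnisotropyChord` / H0 rotor rung: THE LATTICE CONTINUITY EQUATION (stub D1 of THEOREM TWIST-IR,
# theory seat memo ROTOR-THEORY-8 §119), PROVED for `L ≥ 3`

`D_k = [H, ρ_k] = Σ_j ε_j(k) Jʲ_k` with `ε_j(k) = 1 − e^{2πi k_j/L}`, `|ε_j|² = 2(1 − cos(2πk_j/L))`, as an identity of
OPERATORS on the hard-core boson / XXZ torus `(ℤ/L)²`, `L ≥ 3` (`continuity_eq`; at `L ≤ 2` the directed bonds do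
not enumerate the edges).  Proof: both sides act on a basis configuration `σ` by hops across flippable bonds
(`xxz_mulVec_apply`, `bondCurrent_mulVec_apply`); across `{x, x+e_j}` the density mode changes by
`φ_k(x) − φ_k(x+e_j) = φ_k(x) ε_j` (`densityMode_comp_swap`), with the orientation sign carried by the current;
edges ↔ directed bonds by `sum_edge_eq_sum_bond`.
-/

set_option linter.dupNamespace false

noncomputable section

open Matrix Complex Finset
open scoped ComplexConjugate
open Literature.MathematicalPhysics.QuantumLattice hiding torusPhase torusNorm
open Literature.Probability.LatticeModels
open Summit.HubbardSuperconductivity.HubbardSuperconductivity.Theorems.AnisotropyChord.OneMagnon (xxz_mulVec_apply)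
open Summit.HubbardSuperconductivity.HubbardSuperconductivity.Theorems.AnisotropyChord.InsertionEntropy
  (torusPhase norm_torusPhase torusPhase_add_right)

namespace Summit.HubbardSuperconductivity.HubbardSuperconductivity.Theorems.AnisotropyChord.Stiffness

variable {L : ℕ} [NeZero L]

/-- **Action of the current divergence on a vector:** `(D_k v)(σ) = ½ Σ_{e} [σ flippable at e] (ρ_k(σ) − ρ_k(σ^e)) v(σ^e)`. [folklore] -/
theorem currentDiv_mulVec_apply (Δ : ℝ) (k : TorusSite 2 L) (v : TensorIndex (TorusSite 2 L) 2 → ℂ)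
    (σ : TensorIndex (TorusSite 2 L) 2) :
    (currentDiv L Δ k *ᵥ v) σ
      = (1 / 2 : ℂ) * ∑ e ∈ (torusGraph 2 L).edgeFinset, Sym2.lift ⟨fun x y =>
          if σ x ≠ σ y then
            ((∑ s, if σ s = 0 then torusPhase L k s else 0)
              - (∑ s, if (σ ∘ Equiv.swap x y) s = 0 then torusPhase L k s else 0)) * v (σ ∘ Equiv.swap x y)
          else 0, fun x y => by simp only [ne_comm, Equiv.swap_comm]⟩ e := by
  unfold currentDiv densityModeOp
  rw [Matrix.sub_mulVec, Pi.sub_apply, ← Matrix.mulVec_mulVec, ← Matrix.mulVec_mulVec, mulVec_diagonal,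
    xxz_mulVec_apply, xxz_mulVec_apply]
  simp only [mulVec_diagonal]
  have h1 : ∑ e ∈ (torusGraph 2 L).edgeFinset, Sym2.lift ⟨fun x y =>
          if σ x ≠ σ y then
            ((∑ s, if σ s = 0 then torusPhase L k s else 0)
              - (∑ s, if (σ ∘ Equiv.swap x y) s = 0 then torusPhase L k s else 0)) * v (σ ∘ Equiv.swap x y)
          else 0, fun x y => by simp only [ne_comm, Equiv.swap_comm]⟩ e
      = (∑ s, if σ s = 0 then torusPhase L k s else 0) * ∑ e ∈ (torusGraph 2 L).edgeFinset, Sym2.lift ⟨fun x y =>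
          if σ x ≠ σ y then v (σ ∘ Equiv.swap x y) else 0, fun x y => by simp only [ne_comm, Equiv.swap_comm]⟩ e
        - ∑ e ∈ (torusGraph 2 L).edgeFinset, Sym2.lift ⟨fun x y =>
          if σ x ≠ σ y then
            (∑ s, if (σ ∘ Equiv.swap x y) s = 0 then torusPhase L k s else 0) * v (σ ∘ Equiv.swap x y)
          else 0, fun x y => by simp only [ne_comm, Equiv.swap_comm]⟩ e := by
    rw [Finset.mul_sum, ← Finset.sum_sub_distrib]
    refine Finset.sum_congr rfl fun e _ => ?_
    induction e using Sym2.ind with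
    | h x y =>
      simp only [Sym2.lift_mk]
      split_ifs <;> ring
  rw [h1]
  ring

/-- **Action of the current-mode combination `Σ_j ε_j Jʲ_k` with `ε_j = 1 − φ_k(e_j)`:** the same hop sum over the
directed bonds. [folklore] -/
theorem currentModes_mulVec_apply (hL : 3 ≤ L) (k : TorusSite 2 L) (v : TensorIndex (TorusSite 2 L) 2 → ℂ)
    (σ : TensorIndex (TorusSite 2 L) 2) :
    ((∑ j : Fin 2, (1 - torusPhase L k (Pi.single j 1)) • currentMode L k j) *ᵥ v) σ
      = (1 / 2 : ℂ) * ∑ p : TorusSite 2 L × Fin 2,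
          (if σ p.1 ≠ σ (p.1 + Pi.single p.2 1) then
            ((∑ s, if σ s = 0 then torusPhase L k s else 0)
              - (∑ s, if (σ ∘ Equiv.swap p.1 (p.1 + Pi.single p.2 1)) s = 0 then torusPhase L k s else 0))
              * v (σ ∘ Equiv.swap p.1 (p.1 + Pi.single p.2 1))
          else 0) := by
  unfold currentMode
  rw [Matrix.sum_mulVec, Finset.sum_apply, Finset.mul_sum, Fintype.sum_prod_type_right]
  refine Finset.sum_congr rfl fun j _ => ?_
  rw [Matrix.smul_mulVec, Pi.smul_apply, Matrix.sum_mulVec, Finset.sum_apply, smul_eq_mul, Finset.mul_sum]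
  refine Finset.sum_congr rfl fun x _ => ?_
  have hxy : x ≠ x + Pi.single j 1 := Ne.symm (add_single_ne_self (by omega) x j)
  rw [Matrix.smul_mulVec, Pi.smul_apply, smul_eq_mul, bondCurrent_mulVec_apply hxy]
  have fin2 : ∀ t : Fin 2, t = 0 ∨ t = 1 := by decide
  rcases fin2 (σ x) with hx | hx <;> rcases fin2 (σ (x + Pi.single j 1)) with hy | hy
  · simp [hx, hy]
  · rw [if_pos ⟨hx, hy⟩, if_pos (by rw [hx, hy]; decide), densityMode_comp_swap hxy σ hx hy k,
      torusPhase_add_right]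
    ring
  · have hno : ¬ (σ x = 0 ∧ σ (x + Pi.single j 1) = 1) := by rw [hx]; intro h; exact absurd h.1 (by decide)
    rw [if_neg hno, if_pos ⟨hx, hy⟩, if_pos (by rw [hx, hy]; decide)]
    have h := densityMode_comp_swap (Ne.symm hxy) σ hy hx k
    rw [Equiv.swap_comm] at h
    rw [h, torusPhase_add_right]
    ring
  · simp [hx, hy]

/-- **THE LATTICE CONTINUITY EQUATION** (`L ≥ 3`): `D_k = Σ_j (1 − φ_k(e_j)) Jʲ_k` as operators. [folklore] -/
theorem currentDiv_eq_sum_currentMode (hL : 3 ≤ L) (Δ : ℝ) (k : TorusSite 2 L) :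
    currentDiv L Δ k = ∑ j : Fin 2, (1 - torusPhase L k (Pi.single j 1)) • currentMode L k j := by
  have hv : ∀ v : TensorIndex (TorusSite 2 L) 2 → ℂ,
      currentDiv L Δ k *ᵥ v = (∑ j : Fin 2, (1 - torusPhase L k (Pi.single j 1)) • currentMode L k j) *ᵥ v := by
    intro v
    funext σ
    rw [currentDiv_mulVec_apply Δ k v σ, currentModes_mulVec_apply hL k v σ, sum_edge_eq_sum_bond hL]
    simp only [Sym2.lift_mk]
  ext σ τ
  have hτ := congrFun (hv (Pi.single τ 1)) σ
  rw [Matrix.mulVec_single_one, Matrix.mulVec_single_one] at hτ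
  exact hτ

/-- `|1 − φ_k(e_j)|² = 2(1 − cos(2πk_j/L))`. [folklore] -/
theorem norm_one_sub_torusPhase_single_sq (hL : 2 ≤ L) (k : TorusSite 2 L) (j : Fin 2) :
    ‖1 - torusPhase L k (Pi.single j 1)‖ ^ 2 = 2 * fsumWeight L k j := by
  have h := norm_torusPhase_sub_sq hL k 0 j
  rw [zero_add, InsertionEntropy.torusPhase_zero_right] at h
  exact h

/-- **STUB (D1) — `ContinuityEquation`** (theory seat Sketch8 Part O, memo ROTOR-THEORY-8 §119; exact lattice
algebra): for `L ≥ 3` the current divergence is a combination of the two current modes,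
`D_k = [H, ρ_k] = Σ_j ε_j(k) Jʲ_k` with `|ε_j(k)|² = 2(1 − cos(2πk_j/L))` (the phase convention is left existential
so that only `torusPhase`'s modulus matters).
[conjecture: theory seat hubbard-h0-rotor-theory-1, cycle 8, 2026-08-28 — memo ROTOR-THEORY-8 §119 stub (D1); PROVED below (`continuityEquation_holds`)] -/
def ContinuityEquation : Prop :=
  ∀ (L : ℕ) [NeZero L], 3 ≤ L → ∀ (Δ : ℝ) (k : TorusSite 2 L),
    ∃ ε : Fin 2 → ℂ, (∀ j, ‖ε j‖ ^ 2 = 2 * fsumWeight L k j) ∧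
      currentDiv L Δ k = ∑ j, ε j • currentMode L k j

/-- **`ContinuityEquation` HOLDS** (stub D1 of THEOREM TWIST-IR is a tree theorem). [folklore] -/
theorem continuityEquation_holds : ContinuityEquation := by
  intro L _ hL Δ k
  refine ⟨fun j => 1 - torusPhase L k (Pi.single j 1), fun j => norm_one_sub_torusPhase_single_sq (by omega) k j, ?_⟩
  exact currentDiv_eq_sum_currentMode hL Δ k

end Summit.HubbardSuperconductivity.HubbardSuperconductivity.Theorems.AnisotropyChord.Stiffness
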